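import Summits.QuantumAdvantage.AdviceFreeQNC0.WalkHardFShotsSqrt
import HarnessLib

/-!
# Cell qa-qnc0 (odd primes `p ≥ 5`): the SHOTS / DENSE dichotomy — `WalkHardF p` is literally the dense residual

Planner qa-qnc0-p2 g14, `line14/Sketch14p2.lean` §1/§6 (statements `shotCount`, `maxShots`, `SparseOfShots`,
`WalkHardFDenseResidual`, `DichotomyOfShots` VERBATIM) and the `√n` analogue of the residual for rung R6
(`WalkHardFShotsSqrt.lean`).  PROVED here, for every prime `p`:

* `sparseOfShots : SparseOfShots p` — `WalkHardFShots p → WalkHardFSparse p` (`s` potentially-active cuts ⇒ `≤ s` shots);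
* `dichotomyOfShots : DichotomyOfShots p` — `WalkHardFShots p → WalkHardFDenseResidual p → WalkHardF p` (case split on
  `maxShots³·(log₂ n)^{2C+2} ≤ n`; the route item `DichotomyGlue` of `OddPrimeWalk` is the `∀ p ≥ 5` form, qn-prover g10);
* **`WalkHardFDenseResidualSqrt p`** (typed here): the residual of R6 — strategies with `¬ (maxShots²·(log₂ n)^{2C+3} ≤ n)`,
  i.e. some input fires `≳ √n/polylog` cuts — and `walkHardF_of_shotsSqrt_denseSqrt : WalkHardFShotsSqrt p →
  WalkHardFDenseResidualSqrt p → WalkHardF p`;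
* **`walkHardF_of_denseResidualSqrt (p) (hp3 : p ≠ 3) : WalkHardFDenseResidualSqrt p → WalkHardF p`** — with R6 landed
  (`walkHardFShotsSqrt`), the crux `WalkHardF p` for `p ≥ 5` IS the `√n`-dense residual, nothing more.

WHAT THIS IS NOT: the residual itself (`DenseResidualOdd` / `WalkHardFDenseResidualSqrt`) is the open problem of the line
(ROUND-14 §4; CDH-adjacent); separation NOT moved.
-/

noncomputable section

namespace Summit.QuantumAdvantage.AdviceFreeQNC0

open Classical
open Finset

variable {n : ℕ}

/-! ### Statements (planner qa-qnc0-p2 Sketch14p2 §1/§6, verbatim) -/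

/-- Number of fired cuts («shots») of strategy `y` on input `u`. (Sketch14p2 §1, verbatim.) -/
def shotCount (y : Fin (n + 1) → (Fin n → Bool) → Bool) (u : Fin n → Bool) : ℕ :=
  (univ.filter fun g : Fin (n + 1) => y g u = true).card

/-- Maximal number of shots over all inputs. (Sketch14p2 §1, verbatim.) -/
def maxShots (y : Fin (n + 1) → (Fin n → Bool) → Bool) : ℕ := univ.sup (shotCount y)

/-- Every input fires at most `maxShots` cuts. (Sketch14p2 §1.) -/
theorem shotCount_le_maxShots (y : Fin (n + 1) → (Fin n → Bool) → Bool) (u : Fin n → Bool) :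
    shotCount y u ≤ maxShots y := Finset.le_sup (f := shotCount y) (mem_univ u)

/-- Shots never exceed the number of potentially-active cuts (so `WalkHardFShots` contains `WalkHardFSparse`). (Sketch14p2 §1.) -/
theorem shotCount_le_activeCuts (y : Fin (n + 1) → (Fin n → Bool) → Bool) (u : Fin n → Bool) :
    shotCount y u ≤ (activeCuts y).card := by
  unfold shotCount activeCuts
  exact card_le_card (fun g hg => by
    simp only [mem_filter, mem_univ, true_and] at hg ⊢; exact ⟨u, hg⟩)

/-- `WalkHardFShots p → WalkHardFSparse p` (S, `shotCount ≤ #activeCuts` and `(log₂ n)^{2C+2} ≤ (log₂ n)^{2C+3}`).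
(Sketch14p2 §6, verbatim.) PROVED: `sparseOfShots`. -/
def SparseOfShots (p : ℕ) [Fact p.Prime] : Prop := WalkHardFShots p → WalkHardFSparse p

/-- The dense residual of `WalkHardF p` left by the shots rung (route item `OddPrimeWalk.DenseResidualOdd` is `∀ p ≥ 5`, this).
(Sketch14p2 §6, verbatim; OPEN.) -/
def WalkHardFDenseResidual (p : ℕ) [Fact p.Prime] : Prop :=
  ∃ θ : ℝ, θ < 1 ∧ ∀ C : ℕ, ∃ n₀ : ℕ, ∀ n ≥ n₀, ∀ c : ℕ, ∀ y : Fin (n + 1) → (Fin n → Bool) → Bool,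
    (∀ g, HasDegF p (y g) ((Nat.log 2 n) ^ C)) →
    ¬ ((univ.sup fun u : Fin n → Bool => (univ.filter fun g : Fin (n + 1) => y g u = true).card) ^ 3
         * (Nat.log 2 n) ^ (2 * C + 2) ≤ n) →
      ((univ.filter fun u : Fin n → Bool => ringWinU c y u = true).card : ℝ) ≤ θ * (2 : ℝ) ^ n

/-- The dichotomy glue (S: `θ := max`, `n₀ := max`, case split on `maxShots³·(log₂ n)^{2C+2} ≤ n`).
(Sketch14p2 §6, verbatim.) PROVED: `dichotomyOfShots`. -/
def DichotomyOfShots (p : ℕ) [Fact p.Prime] : Prop :=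
  WalkHardFShots p → WalkHardFDenseResidual p → WalkHardF p

/-- **`WalkHardFDenseResidualSqrt p`** (typed here): the DENSE RESIDUAL OF RUNG R6 — strategies outside the `√n`-shots regime,
`¬ (maxShots²·(log₂ n)^{2C+3} ≤ n)` (some input fires `≳ √n/(log₂ n)^{C+3/2}` cuts).  OPEN; with `walkHardFShotsSqrt` it is ALL of
`WalkHardF p` (`walkHardF_of_denseResidualSqrt`). -/
def WalkHardFDenseResidualSqrt (p : ℕ) [Fact p.Prime] : Prop :=
  ∃ θ : ℝ, θ < 1 ∧ ∀ C : ℕ, ∃ n₀ : ℕ, ∀ n ≥ n₀, ∀ c : ℕ, ∀ y : Fin (n + 1) → (Fin n → Bool) → Bool,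
    (∀ g, HasDegF p (y g) ((Nat.log 2 n) ^ C)) →
    ¬ ((univ.sup fun u : Fin n → Bool => (univ.filter fun g : Fin (n + 1) => y g u = true).card) ^ 2
         * (Nat.log 2 n) ^ (2 * C + 3) ≤ n) →
      ((univ.filter fun u : Fin n → Bool => ringWinU c y u = true).card : ℝ) ≤ θ * (2 : ℝ) ^ n

/-! ### Proofs -/

/-- **`SparseOfShots p` — PROVED.** -/
theorem sparseOfShots (p : ℕ) [Fact p.Prime] : SparseOfShots p := by
  rintro ⟨θ, hθ, h⟩
  refine ⟨θ, hθ, fun C => ?_⟩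
  obtain ⟨n₀, hn₀⟩ := h C
  refine ⟨max n₀ 2, fun n hn c y hdeg hbud => hn₀ n (le_trans (le_max_left _ _) hn) c (activeCuts y).card y hdeg
    (fun u => shotCount_le_activeCuts y u) ?_⟩
  have hlog : 1 ≤ Nat.log 2 n := Nat.le_log_of_pow_le (by norm_num) (le_trans (le_max_right _ _) hn)
  calc (activeCuts y).card ^ 3 * (Nat.log 2 n) ^ (2 * C + 2)
      ≤ (activeCuts y).card ^ 3 * (Nat.log 2 n) ^ (2 * C + 3) :=
        Nat.mul_le_mul_left _ (Nat.pow_le_pow_right hlog (by omega))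
    _ ≤ n := hbud

/-- The generic dichotomy: hardness inside a regime `R` and hardness outside it give `WalkHardF p`. -/
theorem walkHardF_of_regime (p : ℕ) [Fact p.Prime] (R : ∀ {n : ℕ}, ℕ → (Fin (n + 1) → (Fin n → Bool) → Bool) → Prop)
    (hin : ∃ θ : ℝ, θ < 1 ∧ ∀ C : ℕ, ∃ n₀ : ℕ, ∀ n ≥ n₀, ∀ c : ℕ, ∀ y : Fin (n + 1) → (Fin n → Bool) → Bool,
      (∀ g, HasDegF p (y g) ((Nat.log 2 n) ^ C)) → R C y →
        ((univ.filter fun u : Fin n → Bool => ringWinU c y u = true).card : ℝ) ≤ θ * (2 : ℝ) ^ n)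
    (hout : ∃ θ : ℝ, θ < 1 ∧ ∀ C : ℕ, ∃ n₀ : ℕ, ∀ n ≥ n₀, ∀ c : ℕ, ∀ y : Fin (n + 1) → (Fin n → Bool) → Bool,
      (∀ g, HasDegF p (y g) ((Nat.log 2 n) ^ C)) → ¬ R C y →
        ((univ.filter fun u : Fin n → Bool => ringWinU c y u = true).card : ℝ) ≤ θ * (2 : ℝ) ^ n) :
    WalkHardF p := by
  obtain ⟨θ₁, hθ₁, h₁⟩ := hin
  obtain ⟨θ₂, hθ₂, h₂⟩ := hout
  refine ⟨max θ₁ θ₂, max_lt hθ₁ hθ₂, fun C => ?_⟩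
  obtain ⟨n₁, hn₁⟩ := h₁ C
  obtain ⟨n₂, hn₂⟩ := h₂ C
  refine ⟨max n₁ n₂, fun n hn c y hdeg => ?_⟩
  have h2n : (0 : ℝ) ≤ (2 : ℝ) ^ n := by positivity
  by_cases hR : R C y
  · exact le_trans (hn₁ n (le_trans (le_max_left _ _) hn) c y hdeg hR)
      (mul_le_mul_of_nonneg_right (le_max_left _ _) h2n)
  · exact le_trans (hn₂ n (le_trans (le_max_right _ _) hn) c y hdeg hR)
      (mul_le_mul_of_nonneg_right (le_max_right _ _) h2n)

/-- **`DichotomyOfShots p` — PROVED** (`B := maxShots y`, `shotCount_le_maxShots`). -/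
theorem dichotomyOfShots (p : ℕ) [Fact p.Prime] : DichotomyOfShots p := by
  intro hSh hR
  refine walkHardF_of_regime p (fun {n} C y =>
    (univ.sup fun u : Fin n → Bool => (univ.filter fun g : Fin (n + 1) => y g u = true).card) ^ 3
      * (Nat.log 2 n) ^ (2 * C + 2) ≤ n) ?_ hR
  obtain ⟨θ, hθ, h⟩ := hSh
  refine ⟨θ, hθ, fun C => ?_⟩
  obtain ⟨n₀, hn₀⟩ := h C
  exact ⟨n₀, fun n hn c y hdeg hbud => hn₀ n hn c _ y hdeg (fun u => shotCount_le_maxShots y u) hbud⟩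

/-- **The `√n` dichotomy**: `WalkHardFShotsSqrt p → WalkHardFDenseResidualSqrt p → WalkHardF p`. -/
theorem walkHardF_of_shotsSqrt_denseSqrt (p : ℕ) [Fact p.Prime] (hSh : WalkHardFShotsSqrt p)
    (hR : WalkHardFDenseResidualSqrt p) : WalkHardF p := by
  refine walkHardF_of_regime p (fun {n} C y =>
    (univ.sup fun u : Fin n → Bool => (univ.filter fun g : Fin (n + 1) => y g u = true).card) ^ 2
      * (Nat.log 2 n) ^ (2 * C + 3) ≤ n) ?_ hR
  obtain ⟨θ, hθ, h⟩ := hSh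
  refine ⟨θ, hθ, fun C => ?_⟩
  obtain ⟨n₀, hn₀⟩ := h C
  exact ⟨n₀, fun n hn c y hdeg hbud => hn₀ n hn c _ y hdeg (fun u => shotCount_le_maxShots y u) hbud⟩

/-- **For every prime `p ≠ 3`, `WalkHardF p` IS its `√n`-dense residual** (R6 `walkHardFShotsSqrt` covers the rest). -/
theorem walkHardF_of_denseResidualSqrt (p : ℕ) [Fact p.Prime] (hp3 : p ≠ 3) (hR : WalkHardFDenseResidualSqrt p) :
    WalkHardF p :=
  walkHardF_of_shotsSqrt_denseSqrt p (walkHardFShotsSqrt p hp3) hR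

end Summit.QuantumAdvantage.AdviceFreeQNC0

end
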